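import Summits.BirchSwinnertonDyer.BirchSwinnertonDyer.Theorems.GenusKolyvaginAtTwoOffCutResidualAtTwoRStrictDefTwoIdentityPrime
import Summits.BirchSwinnertonDyer.BirchSwinnertonDyer.Theorems.GenusKolyvaginAtTwoShaCardDvdPowAtTwoPosTSupplyRealShift
import Summits.BirchSwinnertonDyer.BirchSwinnertonDyer.Theorems.GenusKolyvaginAtTwoGenusPrimitiveSupplyAtTwoArchimedeanRowsHold
import Summits.BirchSwinnertonDyer.BirchSwinnertonDyer.Theorems.GenusKolyvaginAtTwoGenusPrimitiveSupplyAtTwoPrimeHeegnerTwinSilentPrimes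
import Summits.BirchSwinnertonDyer.BirchSwinnertonDyer.Theorems.GenusKolyvaginAtTwoPowDvdShaCardAtTwoRTLadderFrameBookkeeping
import Summits.BirchSwinnertonDyer.BirchSwinnertonDyer.Theorems.GenusKolyvaginAtTwoGenusPrimitiveSupplyAtTwoDoorSupplyNegDisc
import Summits.BirchSwinnertonDyer.BirchSwinnertonDyer.Theorems.SchneiderFreeAdditiveX3PoitouTateReciprocitySumHolds
import Summits.BirchSwinnertonDyer.Rank1Residual.GaloisImage.LocalEulerPoincareCharacteristicHolds
import Literature.NumberTheory.EllipticCurves.HeegnerFieldOfDiscriminantProofs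
import Literature.NumberTheory.EllipticCurves.QuadraticTwistJInvariantProofs
import HarnessLib

/-!
# Route `GenusKolyvaginAtTwo`, residual `OffCutResidualAtTwoR` (stmt-BirchSwinnertonDyer-31767): LINE 24 «strict_def2» STUB A⁼²
# `stub_minimalTwinSupplyAtTwoPosStrict` PROVED — on the STRICT cell (`Δ > 0`, `#Sel₂(E) = 4`, every Selmer class trivial at `ℝ`)
# a DEFECT-2 Heegner twin `E^{(−ℓp)}` (ℓ silent, `p` an identity prime) is globally minimal, `2`-Selmer-minimal and has `ord₂ C = 2`

Seat `bsd-line-gk2-p5` g39 (WIDTH-5 attach, cell `bsd-f1-sign2`), `--supports stmt-BirchSwinnertonDyer-31767` (helper; closes nothing).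
THEOREMS ONLY (no definition, no named fact, no `sorry`; standard axioms).  **BSD is NOT proved by any of this; no item is closed;
the residual crux `OffCutResidualAtTwoR` and LINE 24's stubs C⁼² (transposition-deep `2`-primitivity, beyond print) / X⁼² (exactness at
defect 2) stay open.**  LINE 24 = `Cruxes/OffCutResidualAtTwoR/Lines/strict_def2.lean` (pen bsd-idea-1 g24/g25, v2, NOT registered, W-79);
its stub A⁼² is also the supply half of LINE 27 «socle_selection»'s declared residual `stub_residual`, slice 3 (`Δ > 0 ∧ #Sel₂ = 4 ∧ not
real-narrow` = STRICT: on these cells NO Tamagawa-odd Heegner twin is `2`-Selmer-minimal, LEAD gk2-p1 g20's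
`natCard_selmerGroup_twin_eq_eight_of_posDisc_of_strict_real_of_natCard_selmerGroup_eq_four`).

THE MECHANISM (every input a tree theorem; this file is the assembly).  On a STRICT cell the all-silent Heegner twin `Wℓ ≅ E^{(−ℓ)}`
(`ℓ ≡ 7 (8)` silent, gk2-p5 g7's Čebotarev supply `GenusKolyTwin.exists_silent_prime_heegnerField`; `ord₂ C(Wℓ) = 0`, gk2-p3) has
`#Sel₂(Wℓ) = 8` (the twist RAISES at `T = {∞}`).  Mazur–Rubin Prop. 5.2 at `p = 2` (LEAD gk2-p1 g8's kernel theorem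
`GenusKolyLowering.exists_prime_card_selmerGroup_quadraticTwist_mul_four_eq`, modulus `8 N ℓ`) then gives a prime `p ≡ 1 (mod 8Nℓ)`, an
IDENTITY prime (`Frob_p = 1` on `E[2]`), with `#Sel₂(Wℓ^{(p)}) · 4 = 8`; and `Wℓ^{(p)} ≅ E^{(−ℓp)}` where `D = −ℓp ≡ 1 (mod 8)` is a
fundamental discriminant with `(D/r) = (−ℓ/r)(p/r) = 1` at every odd `r ∣ N` — a Heegner field of Tamagawa DEFECT `ord₂ C(E^{(D)}) =
ord₂(#roots_ℓ + 1) + ord₂(#roots_p + 1) = 0 + 2` (Kramer; LEAD's `padicValNat_two_tamagawaProduct_twin_eq`).  The card's «type I twin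
(one identity prime, rest silent)» — here with the silent cofactor doing the parity bookkeeping instead of a `T = {∞, q}` Lagrangian count.

* (prequel `…OffCutResidualAtTwoRStrictDefTwoIdentityPrime`, §1 there) `GenusKolyLowering.exists_identityPrime_card_selmerGroup_quadraticTwist_mul_four_eq`
  — LEAD g8's lowering step re-run VERBATIM with the identity bit EXPORTED: `#W(ℚ_p)[2] = 4`.
* §2 `GenusExact.StrictDefTwo.exists_heegnerField_neg_mul` (the field `ℚ(√(−ℓp))` with every K-clause of the route: imaginary quadratic,
  `d_K = −ℓp` odd `≠ −3`, Heegner for `N`, `2` split, the two Theorem-B₂ non-squares); **`exists_defectTwo_twin_of_strict`** (general,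
  ANY Tamagawa product: `#Sel₂(E) = 2^s`, `s ≥ 1`, strict at `ℝ` ⟹ `ℓ, p` as above and a globally minimal `Wd ≅ E^{(−ℓp)}` with
  `#Sel₂(Wd) = 2^{s−1}`, `ord₂ C(Wd) = ord₂ C(E) + 2`); `exists_defectTwo_minimalTwin_of_strict` (`s = 2`, `C(E)` odd: the STRICT cell of LINE 24
  / LINE 27 slice 3, `#Sel₂(Wd) = 2`, `ord₂ C(Wd) = 2`); `exists_defectTwo_selmerTrivialTwin_of_strict` (`s = 1`, every depth: the identity
  locus of U₂ / LINE 23's residual OFF″ off the egg — a `2`-Selmer-TRIVIAL defect-2 twin, supply included; cf. gk2-p2 g26's prime-`d_K` identity door).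
* §3 **`GenusExact.StrictDefTwo.minimalTwinSupplyAtTwoPosStrict`** = the skeleton's `stub_minimalTwinSupplyAtTwoPosStrict` SIGNATURE VERBATIM
  (merged-scratch `example` rc 0), the habitat binders `¬ CM`, `r_an = 0`, `ρ_{2^n}` onto for `n ≥ 2` idle.

References: [MazurRubin2010] Prop. 5.2 (proof, arXiv:0904.3709 p. 12), Lemma 3.6, Cor. 3.4 (i), Lemma 2.11; [Kramer1981] §2 Prop. 3, Prop. 6,
Thm. 1; [GrossLMS1991] §1 (p. 235); [MilneADT2006] I Lemma 3.3, Thm. 2.8, Thm. 4.10; [SerreAbelianLadic1968] Ch. I §2.2 Cor. 2 (a);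
[Marcus2018] Ch. 2 Thm. 1, Ch. 3 Thm. 25.
-/

set_option linter.dupNamespace false -- tree convention: `Summit.BirchSwinnertonDyer.BirchSwinnertonDyer.Theorems` (summit = sub-problem)
set_option autoImplicit false

noncomputable section

open scoped Classical ContRepresentation

/-! ## §2 The DEFECT-2 minimal twin on the STRICT cell: `K = ℚ(√(−ℓp))`, `ℓ` silent, `p` an identity prime -/

namespace Summit.BirchSwinnertonDyer.BirchSwinnertonDyer.Theorems.GenusExact.StrictDefTwo

open WeierstrassCurve Field NumberField IsDedekindDomain Function
open Literature.NumberTheory.EllipticCurves Literature.NumberTheory.GaloisRepresentations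
open Literature.NumberTheory.GaloisCohomology Literature.NumberTheory
open Literature.NumberTheory.QuadraticFields
open Summit.BirchSwinnertonDyer.BirchSwinnertonDyer.Theorems.GenusExact.PlusDescent
open Summit.BirchSwinnertonDyer.BirchSwinnertonDyer.Theorems.SchneiderFreeAdditiveX3.PoitouTateReduction
  (poitouTate_selmerStructure_duality_real_holds)

/-- A nonzero rational with ODD `q`-adic valuation at some prime `q` is not a square in `ℚ`. [folklore] -/
theorem not_isSquare_of_padicValRat_odd {q : ℕ} [Fact q.Prime] {x : ℚ} (hx : x ≠ 0)
    (hodd : Odd (padicValRat q x)) : ¬ IsSquare x := by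
  rintro ⟨y, rfl⟩
  have hy : y ≠ 0 := fun h => hx (by rw [h, mul_zero])
  rw [padicValRat.mul hy hy, ← two_mul] at hodd
  exact (Int.not_odd_iff_even.mpr (even_two_mul _)) hodd

/-- **The Heegner field `ℚ(√(−ℓp))` of a silent/identity pair.**  `W/ℚ` globally minimal elliptic; primes `ℓ ≠ p`, `ℓ > 3`,
`ℓ ≡ 7 (mod 8)`, `p ≡ 1 (mod 8)`, `ℓ ≡ −1` and `p ≡ 1 (mod r)` for every odd prime `r ∣ N_W`, `ℓ ∤ N_W`.  Then `D = −ℓp` is an odd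
fundamental discriminant `≡ 1 (mod 8)`, and `K = ℚ(√D)` is imaginary quadratic with `d_K = D ≠ −3`, satisfies the Heegner hypothesis
for `N_W` (`(D/r) = (−ℓ/r)(p/r) = 1·1`; `2` splits as `D ≡ 1 (mod 8)`), and `d_K·(−|Δ_W|)`, `d_K·(−2|Δ_W|)` are non-squares (their
`ℓ`-adic valuation is `1`: `ℓ ∤ Δ_min`).  [cite: GrossLMS1991, §1 (p. 235)] [cite: Marcus2018, Ch. 2 Thm. 1, Ch. 3 Thm. 25] -/
theorem exists_heegnerField_neg_mul (W : WeierstrassCurve ℚ) [W.IsElliptic] [W.IsGloballyMinimal]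
    {ℓ p : ℕ} (hℓ : ℓ.Prime) (hp : p.Prime) (hℓp : ℓ ≠ p) (h3ℓ : 3 < ℓ) (hℓ8 : ℓ % 8 = 7) (hp8 : (p : ℤ) % 8 = 1)
    (hcong : ∀ r : ℕ, r.Prime → r ∣ W.conductorNorm ℤ → r ≠ 2 → (ℓ : ZMod r) = -1 ∧ (p : ZMod r) = 1)
    (hℓN : ¬ ℓ ∣ W.conductorNorm ℤ) :
    ∃ (K : Type) (_ : Field K) (_ : NumberField K), IsImaginaryQuadratic K ∧ NumberField.discr K = -((ℓ : ℤ) * p) ∧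
      Odd (NumberField.discr K) ∧ NumberField.discr K ≠ -3 ∧ SatisfiesHeegnerHypothesis (W.conductorNorm ℤ) K ∧
      ((Ideal.span {(2 : ℤ)}).primesOver (𝓞 K)).ncard = 2 ∧
      ¬ IsSquare ((NumberField.discr K : ℚ) * -|W.Δ|) ∧ ¬ IsSquare ((NumberField.discr K : ℚ) * (-(2 * |W.Δ|))) := by
  haveI := Fact.mk hℓ
  haveI := Fact.mk hp
  set D : ℤ := -((ℓ : ℤ) * p) with hD
  have hℓp7 : ((ℓ : ℤ) * p) % 8 = 7 := by
    have hℓ8' : (ℓ : ℤ) % 8 = 7 := by exact_mod_cast hℓ8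
    rw [Int.mul_emod, hℓ8', hp8]; norm_num
  have hD8 : D % 8 = 1 := by omega
  have hD4 : D % 4 = 1 := by omega
  have h3 : 3 < (ℓ : ℤ) * p := by
    have : 3 < ℓ * p := lt_of_lt_of_le h3ℓ (Nat.le_mul_of_pos_right ℓ hp.pos)
    exact_mod_cast this
  have hD0 : D < 0 := by omega
  haveI : Fact (D < 0) := ⟨hD0⟩
  have hsf : Squarefree D := by
    rw [← Int.squarefree_natAbs]
    have : D.natAbs = ℓ * p := by rw [hD, Int.natAbs_neg]; exact_mod_cast Int.natAbs_natCast (ℓ * p)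
    rw [this]
    exact (Nat.squarefree_mul ((Nat.coprime_primes hℓ hp).mpr hℓp)).mpr ⟨hℓ.squarefree, hp.squarefree⟩
  have hdisc : NumberField.discr (sqrtField D) = D := discr_sqrtField D hD4 hsf
  have hHe : SatisfiesHeegnerHypothesis (W.conductorNorm ℤ) (sqrtField D) := by
    refine satisfiesHeegnerHypothesis_sqrtField D hD8 hsf fun r hr hrN hr2 ↦ ?_
    haveI := Fact.mk hr
    obtain ⟨hℓr, hpr⟩ := hcong r hr hrN hr2
    rw [← jacobiSym.legendreSym.to_jacobiSym]
    refine Quadratic.legendreSym_eq_one_of_cast_eq_one ?_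
    rw [hD]; push_cast
    rw [hℓr, hpr]; ring
  -- `ℓ`-adic valuations for the two non-square clauses
  have hℓΔ : ¬ (ℓ : ℤ) ∣ minimalDiscriminantInt W := fun h ↦
    hℓN (GenusKolyTwin.dvd_conductorNorm_of_dvd_minimalDiscriminantInt W hℓ h)
  have hℓQ : (ℓ : ℚ) ≠ 0 := by exact_mod_cast hℓ.ne_zero
  have hpQ : (p : ℚ) ≠ 0 := by exact_mod_cast hp.ne_zero
  have hΔQ : (W.Δ : ℚ) ≠ 0 := W.isUnit_Δ.ne_zero
  have hvΔ : padicValRat ℓ W.Δ = 0 := by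
    rw [← cast_minimalDiscriminantInt W, padicValRat.of_int, Int.natCast_eq_zero, padicValInt.eq_zero_of_not_dvd hℓΔ]
  have hvΔabs : padicValRat ℓ |W.Δ| = 0 := by
    rcases abs_choice W.Δ with h | h
    · rw [h, hvΔ]
    · rw [h, padicValRat.neg, hvΔ]
  have hvp : padicValRat ℓ (p : ℚ) = 0 := by
    rw [padicValRat.of_nat, Nat.cast_eq_zero, padicValNat.eq_zero_of_not_dvd]
    exact fun h ↦ hℓp ((Nat.prime_dvd_prime_iff_eq hℓ hp).mp h)
  have hv2 : padicValRat ℓ (2 : ℚ) = 0 := by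
    have h2' : ¬ ℓ ∣ 2 := fun h => by have := Nat.le_of_dvd two_pos h; omega
    rw [show (2 : ℚ) = ((2 : ℕ) : ℚ) by norm_num, padicValRat.of_nat, padicValNat.eq_zero_of_not_dvd h2', Nat.cast_zero]
  have hy0 : (ℓ : ℚ) * p * |W.Δ| ≠ 0 := mul_ne_zero (mul_ne_zero hℓQ hpQ) (abs_ne_zero.mpr hΔQ)
  have hy : padicValRat ℓ ((ℓ : ℚ) * p * |W.Δ|) = 1 := by
    rw [padicValRat.mul (mul_ne_zero hℓQ hpQ) (abs_ne_zero.mpr hΔQ), padicValRat.mul hℓQ hpQ, padicValRat.self hℓ.one_lt,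
      hvp, hvΔabs, add_zero, add_zero]
  refine ⟨sqrtField D, inferInstance, inferInstance, isImaginaryQuadratic_sqrtField D, hdisc,
    by rw [hdisc, Int.odd_iff]; omega, by rw [hdisc]; omega, hHe, ncard_primesOver_two_sqrtField_eq_two D hD8 hsf, ?_, ?_⟩
  · have hx : ((NumberField.discr (sqrtField D) : ℤ) : ℚ) * -|W.Δ| = (ℓ : ℚ) * p * |W.Δ| := by
      rw [hdisc, hD]; push_cast; ring
    rw [hx]
    exact not_isSquare_of_padicValRat_odd (q := ℓ) hy0 (by rw [hy]; exact odd_one)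
  · have hx : ((NumberField.discr (sqrtField D) : ℤ) : ℚ) * (-(2 * |W.Δ|)) = 2 * ((ℓ : ℚ) * p * |W.Δ|) := by
      rw [hdisc, hD]; push_cast; ring
    rw [hx]
    refine not_isSquare_of_padicValRat_odd (q := ℓ) (mul_ne_zero two_ne_zero hy0) ?_
    rw [padicValRat.mul two_ne_zero hy0, hy, hv2, zero_add]
    exact odd_one

/-- **THE DEFECT-2 TWIN OF A REAL-STRICT CURVE (general `2`-Selmer size, ANY Tamagawa product).**  `W/ℚ` globally minimal elliptic with
`Δ_W > 0`, `ρ̄_{W,2}` onto, `#Sel₂(W) = 2^s` with `s ≥ 1` and `Sel₂(W)` STRICT at the real place (every class trivial at `ℝ`).  Then there are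
primes `ℓ ≠ p`, `ℓ > 3`, with `ℓ ≡ 7 (mod 8)` SILENT for `W` (no root of the `2`-division cubic mod `ℓ`), `p ≡ 1 (mod 8)` an IDENTITY
prime for `W` (`#W(ℚ_p)[2] = 4`), `ℓ ≡ −1` and `p ≡ 1 (mod r)` for every odd prime `r ∣ N_W`, `ℓ, p ∤ N_W`, and a GLOBALLY MINIMAL model
`Wd ≅ W^{(−ℓp)}` with **`#Sel₂(Wd) = 2^{s−1}` and `ord₂ C(Wd) = ord₂ C(W) + 2`**.  Assembly (all inputs tree theorems): gk2-p5 g7's silent prime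
`ℓ` (Čebotarev, `F1Sign2.DescAdmissible W (−ℓ)`) and the all-silent twin `Wℓ ≅ W^{(−ℓ)}` with `#Sel₂(Wℓ) = 2^{s+1}` (gk2-p4 g12's T-A law
`natCard_selmerGroup_twist_eq_mul_two_of_descAdmissible_of_strict_frame`: strict at `∞` RAISES, ANY `C(W)`; LEAD gk2-p1 g20's real-place shift law
is the Tamagawa-odd case); Mazur–Rubin Prop. 5.2 at `p = 2` on `Wℓ` (LEAD g8; prequel file: an identity prime `p ≡ 1 (mod 8 N_W ℓ)`
with `#Sel₂(Wℓ^{(p)})·4 = 2^{s+1}`); `Wℓ^{(p)} ≅ W^{(−ℓp)}` (twisting is multiplicative, `Sel₂` is model-invariant); Kramer's twin Tamagawa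
valuation over `K = ℚ(√(−ℓp))`: `ord₂ C(Wd) = ord₂ C(W) + ord₂(#roots_ℓ + 1) + ord₂(#roots_p + 1) = ord₂ C(W) + 0 + 2`.  BSD is NOT proved by this.
[cite: MazurRubin2010, Prop. 5.2 (proof), Cor. 3.4 (i), Lemma 2.11] [cite: Kramer1981, §2 Prop. 3, Prop. 6, Thm. 1]
[cite: SerreAbelianLadic1968, Ch. I §2.2, Cor. 2 (a)] -/
theorem exists_defectTwo_twin_of_strict (W : WeierstrassCurve ℚ) [W.IsElliptic] [W.IsGloballyMinimal]
    (hΔ : 0 < W.Δ) (hsurj : W.HasSurjectiveModNGaloisRep 2)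
    {s : ℕ} (hs : 1 ≤ s) (hSel : Nat.card (W.selmerGroup 2) = 2 ^ s)
    (hstrict : ∀ c ∈ (W.kummerSelmerStructure ((2 : ℕ) : ℤ)).selmerGroup,
      galoisCohomology.localization (W.torsionGaloisModule ((2 : ℕ) : ℤ)) (Sum.inl Rat.infinitePlace) 1 c = 0) :
    ∃ ℓ p : ℕ, ℓ.Prime ∧ p.Prime ∧ ℓ ≠ p ∧ 3 < ℓ ∧ ℓ % 8 = 7 ∧ (p : ℤ) % 8 = 1 ∧
      (∀ r : ℕ, r.Prime → r ∣ W.conductorNorm ℤ → r ≠ 2 → (ℓ : ZMod r) = -1 ∧ (p : ZMod r) = 1) ∧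
      ¬ ℓ ∣ W.conductorNorm ℤ ∧ ¬ p ∣ W.conductorNorm ℤ ∧
      (∀ x : ZMod ℓ, 4 * x ^ 3 + ((integralModelInt W).b₂ : ZMod ℓ) * x ^ 2 +
        2 * ((integralModelInt W).b₄ : ZMod ℓ) * x + ((integralModelInt W).b₆ : ZMod ℓ) ≠ 0) ∧
      (∀ _h : Fact p.Prime, Nat.card {Q : (W.baseChange ℚ_[p]).toAffine.Point // 2 • Q = 0} = 4) ∧
      ∃ (Wd : WeierstrassCurve ℚ) (_ : Wd.IsElliptic) (_ : Wd.IsGloballyMinimal),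
        (∃ C : VariableChange ℚ, C • W.quadraticTwist ((-((ℓ : ℤ) * p) : ℤ) : ℚ) = Wd) ∧
        Nat.card (Wd.selmerGroup 2) = 2 ^ (s - 1) ∧ padicValNat 2 Wd.tamagawaProduct = padicValNat 2 W.tamagawaProduct + 2 := by
  classical
  haveI : Fact (Nat.Prime 2) := ⟨Nat.prime_two⟩
  haveI : NeZero (2 : ℚ) := ⟨by norm_num⟩
  set N : ℕ := W.conductorNorm ℤ with hN
  have hN0 : N ≠ 0 := (W.conductorNorm_pos_holds).ne'
  -- ### the silent prime `ℓ` and the all-silent twin `Wℓ ≅ W^{(−ℓ)}`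
  obtain ⟨ℓ, h3ℓ, hℓ, hℓ8, hℓN, hsil, hadm, hsilQ, K, _, _, hIQ, hdK, hodd, -, hHe, -, -, -⟩ :=
    GenusKolyTwin.exists_silent_prime_heegnerField W hΔ hsurj 3
  haveI := Fact.mk hℓ
  obtain ⟨hℓN', -, -⟩ := GenusKolyTwin.exists_heegnerField_of_prime W hℓ hℓ8 hℓN
  have hd0 : (discr K : ℚ) ≠ 0 := by exact_mod_cast NumberField.discr_ne_zero K
  haveI := W.isElliptic_quadraticTwist hd0
  obtain ⟨C₁, hC₁⟩ := hasGlobalMinimalModel_rat_holds (W.quadraticTwist (discr K : ℚ))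
  set Wℓ : WeierstrassCurve ℚ := C₁ • W.quadraticTwist (discr K : ℚ) with hWℓ
  haveI : Wℓ.IsGloballyMinimal := hC₁
  have hsilAll : ∀ (q : ℕ) [Fact q.Prime], (q : ℤ) ∣ discr K →
      ∀ Q : (W.baseChange ℚ_[q]).toAffine.Point, 2 • Q = 0 → Q = 0 := by
    intro q hq hqd
    have hqℓ : q = ℓ := by
      rw [hdK, Int.dvd_neg] at hqd
      exact (Nat.prime_dvd_prime_iff_eq hq.out hℓ).mp (Int.natCast_dvd_natCast.mp hqd)
    subst hqℓ
    exact hsilQ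
  -- the all-silent twist RAISES on a real-strict curve (gk2-p4 g12's T-A law for `DescAdmissible` parameters, ANY Tamagawa product)
  have hup : Nat.card (Wℓ.selmerGroup 2) = 2 ^ (s + 1) := by
    have hC₁d : C₁ • W.quadraticTwist ((-(ℓ : ℤ) : ℤ) : ℚ) = Wℓ := by rw [hWℓ, hdK]
    have hraise := GenusKolyArch.natCard_selmerGroup_twist_eq_mul_two_of_descAdmissible_of_strict_frame W hΔ hadm hC₁d hstrict
    rw [hraise, hSel, pow_succ]
  have hsurjℓ : Wℓ.HasSurjectiveModNGaloisRep 2 :=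
    GenusKolyTransp.hasSurjectiveModNGaloisRep_two_of_smul_quadraticTwist_eq W hsurj hd0 (rfl : C₁ • _ = Wℓ)
  -- ### Mazur–Rubin Prop. 5.2 on `Wℓ`: an identity prime `p ≡ 1 (mod 8 N ℓ)`
  have h3 : 3 ≤ Nat.card (Wℓ.selmerGroup (2 : ℤ)) := by
    rw [hup]
    calc 3 ≤ 2 ^ 2 := by norm_num
      _ ≤ 2 ^ (s + 1) := Nat.pow_le_pow_right (by norm_num) (by omega)
  obtain ⟨x, hxS, y, hyS, hx, hy, hxy⟩ := GenusKolyLowering.exists_ne_ne_of_three_le_natCard (Wℓ.selmerGroup (2 : ℤ)) h3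
  have hm0 : 8 * (N * ℓ) ≠ 0 := mul_ne_zero (by norm_num) (mul_ne_zero hN0 hℓ.ne_zero)
  have hEP : ∀ v : HeightOneSpectrum (𝓞 ℚ), localEulerPoincareCharacteristic (v.adicCompletion ℚ) := fun v ↦
    haveI : CharZero (v.adicCompletion ℚ) := charZero_of_injective_algebraMap (algebraMap ℚ _).injective
    localEulerPoincareCharacteristic_holds (v.adicCompletion ℚ)
  obtain ⟨p, hp, hpmod, hpm, -, hident, hcount⟩ :=
    GenusKolyLowering.exists_identityPrime_card_selmerGroup_quadraticTwist_mul_four_eq Wℓ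
      (poitouTate_selmerStructure_duality_real_holds (K := ℚ)) hEP hsurjℓ hxS hyS hx hy hxy hm0
  haveI := Fact.mk hp
  -- congruences / coprimalities of `p`
  have hp8 : (p : ℤ) % 8 = 1 := by
    have h := (hpmod.of_dvd (show (8 : ℤ) ∣ ((8 * (N * ℓ) : ℕ) : ℤ) by push_cast; exact dvd_mul_right 8 _)).eq
    omega
  have hpr : ∀ r : ℕ, r ∣ N → (p : ℤ) ≡ 1 [ZMOD (r : ℤ)] := fun r hr ↦
    hpmod.of_dvd (by push_cast; exact ((Int.natCast_dvd_natCast.mpr hr).mul_right (ℓ : ℤ)).mul_left 8)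
  have hℓp : ℓ ≠ p := by
    rintro rfl
    exact hpm ⟨2 * 8 * N, by ring⟩
  have hpN : ¬ p ∣ N := fun h ↦ hpm (by exact (h.mul_right ℓ).mul_left (2 * 8) |>.trans ⟨1, by ring⟩)
  have hp2 : p ≠ 2 := by rintro rfl; omega
  have hpΔ : ¬ (p : ℤ) ∣ minimalDiscriminantInt W := fun h ↦
    hpN (GenusKolyTwin.dvd_conductorNorm_of_dvd_minimalDiscriminantInt W hp h)
  have hcong : ∀ r : ℕ, r.Prime → r ∣ N → r ≠ 2 → (ℓ : ZMod r) = -1 ∧ (p : ZMod r) = 1 := fun r hr hrN hr2 ↦ by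
    refine ⟨hℓN r hr hrN hr2, ?_⟩
    have h := (ZMod.intCast_eq_intCast_iff (p : ℤ) 1 r).mpr (hpr r hrN)
    rwa [Int.cast_one, Int.cast_natCast] at h
  -- ### the identity clause read on `W`: `#W(ℚ_p)[2] = 4`, i.e. three roots mod `p`
  have hidW : Nat.card {Q : (W.baseChange ℚ_[p]).toAffine.Point // 2 • Q = 0} = 4 := by
    rw [← natCard_twoTorsion_baseChange_twin_eq W Wℓ hd0 C₁ rfl ℚ_[p]]
    exact hident inferInstance
  have hroots3 : ({x : ZMod p | 4 * x ^ 3 + ((integralModelInt W).b₂ : ZMod p) * x ^ 2 +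
      2 * ((integralModelInt W).b₄ : ZMod p) * x + ((integralModelInt W).b₆ : ZMod p) = 0}).ncard = 3 := by
    have h := GenusKolyTwin.natCard_twoTorsion_padic_eq W hp2 hpΔ
    rw [hidW] at h
    omega
  have hroots0 : ({x : ZMod ℓ | 4 * x ^ 3 + ((integralModelInt W).b₂ : ZMod ℓ) * x ^ 2 +
      2 * ((integralModelInt W).b₄ : ZMod ℓ) * x + ((integralModelInt W).b₆ : ZMod ℓ) = 0}).ncard = 0 := by
    have hempty : {x : ZMod ℓ | 4 * x ^ 3 + ((integralModelInt W).b₂ : ZMod ℓ) * x ^ 2 +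
        2 * ((integralModelInt W).b₄ : ZMod ℓ) * x + ((integralModelInt W).b₆ : ZMod ℓ) = 0} = ∅ :=
      Set.eq_empty_iff_forall_notMem.mpr fun x hx ↦ hsil x hx
    rw [hempty, Set.ncard_empty]
  -- ### the Heegner field `K' = ℚ(√(−ℓp))`
  obtain ⟨K', _, _, hIQ', hdisc, hodd', -, hHe', -, -, -⟩ :=
    exists_heegnerField_neg_mul W hℓ hp hℓp h3ℓ hℓ8 hp8 hcong hℓN'
  set D : ℤ := -((ℓ : ℤ) * p) with hD
  -- ### the globally minimal model `Wd ≅ W^{(D)}` and `Wℓ^{(p)} ≅ Wd`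
  have hDQ : (D : ℚ) ≠ 0 := by
    have : (0 : ℤ) < (ℓ : ℤ) * p := by exact_mod_cast Nat.mul_pos hℓ.pos hp.pos
    have hD0 : D ≠ 0 := by omega
    exact_mod_cast hD0
  haveI := W.isElliptic_quadraticTwist hDQ
  obtain ⟨C₂, hC₂⟩ := hasGlobalMinimalModel_rat_holds (W.quadraticTwist (D : ℚ))
  set Wd : WeierstrassCurve ℚ := C₂ • W.quadraticTwist (D : ℚ) with hWd
  haveI : Wd.IsGloballyMinimal := hC₂
  have hp0 : (p : ℚ) ≠ 0 := by exact_mod_cast hp.ne_zero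
  haveI := Wℓ.isElliptic_quadraticTwist hp0
  have htwist : Wℓ.quadraticTwist (p : ℚ) =
      ((⟨C₁.u, (p : ℚ) * C₁.r, 0, 0⟩ : VariableChange ℚ) * C₂⁻¹) • Wd := by
    rw [hWℓ, quadraticTwist_smul, quadraticTwist_quadraticTwist, mul_smul, hWd, inv_smul_smul]
    congr 2
    rw [hdK, hD]; push_cast; ring
  have hSelWd : Nat.card (Wd.selmerGroup 2) = 2 ^ (s - 1) := by
    have h2 : Nat.card ((Wℓ.quadraticTwist (p : ℚ)).selmerGroup 2) = Nat.card (Wd.selmerGroup 2) := by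
      rw [htwist]
      exact_mod_cast natCard_selmerGroup_smul Wd _ (n := 2) two_ne_zero
    have hpow : 2 ^ (s + 1) = 2 ^ (s - 1) * 4 := by
      rw [show (4 : ℕ) = 2 ^ 2 by norm_num, ← pow_add]
      congr 1
      omega
    rw [h2, hup, hpow] at hcount
    exact Nat.eq_of_mul_eq_mul_right (by norm_num) hcount
  -- ### Kramer: `ord₂ C(Wd) = ord₂ C(W) + ord₂(0 + 1) + ord₂(3 + 1) = ord₂ C(W) + 2`
  have hTamWd : padicValNat 2 Wd.tamagawaProduct = padicValNat 2 W.tamagawaProduct + 2 := by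
    have hC₂' : C₂ • W.quadraticTwist (NumberField.discr K' : ℚ) = Wd := by rw [hdisc]
    rw [padicValNat_two_tamagawaProduct_twin_eq W hIQ' hodd' hHe' C₂ hC₂', hdisc]
    congr 1
    have hnat : (-((ℓ : ℤ) * p)).natAbs = ℓ * p := by rw [Int.natAbs_neg]; exact_mod_cast Int.natAbs_natCast (ℓ * p)
    rw [hnat, Nat.primeFactors_mul hℓ.ne_zero hp.ne_zero, hℓ.primeFactors, hp.primeFactors,
      Finset.sum_union (Finset.disjoint_singleton.mpr hℓp), Finset.sum_singleton, Finset.sum_singleton, hroots0, hroots3]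
    have h4 : padicValNat 2 (3 + 1) = 2 := by
      rw [show (3 + 1 : ℕ) = 2 ^ 2 by norm_num, padicValNat.prime_pow]
    rw [h4, zero_add, padicValNat_one_right, zero_add]
  -- ### assembly
  exact ⟨ℓ, p, hℓ, hp, hℓp, h3ℓ, hℓ8, hp8, hcong, hℓN', hpN, hsil, fun _ ↦ hidW,
    Wd, inferInstance, hC₂, ⟨C₂, rfl⟩, hSelWd, hTamWd⟩

/-- **THE DEFECT-2 MINIMAL TWIN ON THE STRICT CELL (LINE 24 «strict_def2» stub A⁼², core form: `s = 2`, `C(W)` odd).**  `#Sel₂(W) = 4`,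
strict at `ℝ`, `C(W)` odd ⟹ the defect-2 twin `Wd ≅ W^{(−ℓp)}` (ℓ silent, `p` an identity prime, globally minimal) has `#Sel₂(Wd) = 2`,
`ord₂ C(Wd) = 2`.
BSD is NOT proved by this. [cite: MazurRubin2010, Prop. 5.2, Cor. 3.4 (i)] [cite: Kramer1981, §2 Prop. 3, Thm. 1] -/
theorem exists_defectTwo_minimalTwin_of_strict (W : WeierstrassCurve ℚ) [W.IsElliptic] [W.IsGloballyMinimal]
    (hΔ : 0 < W.Δ) (hTam : Odd W.tamagawaProduct) (hsurj : W.HasSurjectiveModNGaloisRep 2)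
    (h4 : Nat.card (W.selmerGroup 2) = 4)
    (hstrict : ∀ c ∈ (W.kummerSelmerStructure ((2 : ℕ) : ℤ)).selmerGroup,
      galoisCohomology.localization (W.torsionGaloisModule ((2 : ℕ) : ℤ)) (Sum.inl Rat.infinitePlace) 1 c = 0) :
    ∃ ℓ p : ℕ, ℓ.Prime ∧ p.Prime ∧ ℓ ≠ p ∧ 3 < ℓ ∧ ℓ % 8 = 7 ∧ (p : ℤ) % 8 = 1 ∧
      (∀ r : ℕ, r.Prime → r ∣ W.conductorNorm ℤ → r ≠ 2 → (ℓ : ZMod r) = -1 ∧ (p : ZMod r) = 1) ∧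
      ¬ ℓ ∣ W.conductorNorm ℤ ∧ ¬ p ∣ W.conductorNorm ℤ ∧
      (∀ x : ZMod ℓ, 4 * x ^ 3 + ((integralModelInt W).b₂ : ZMod ℓ) * x ^ 2 +
        2 * ((integralModelInt W).b₄ : ZMod ℓ) * x + ((integralModelInt W).b₆ : ZMod ℓ) ≠ 0) ∧
      (∀ _h : Fact p.Prime, Nat.card {Q : (W.baseChange ℚ_[p]).toAffine.Point // 2 • Q = 0} = 4) ∧
      ∃ (Wd : WeierstrassCurve ℚ) (_ : Wd.IsElliptic) (_ : Wd.IsGloballyMinimal),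
        (∃ C : VariableChange ℚ, C • W.quadraticTwist ((-((ℓ : ℤ) * p) : ℤ) : ℚ) = Wd) ∧
        Nat.card (Wd.selmerGroup 2) = 2 ∧ padicValNat 2 Wd.tamagawaProduct = 2 := by
  have h4' : Nat.card (W.selmerGroup 2) = 2 ^ 2 := by rw [h4]; norm_num
  have hW0 : padicValNat 2 W.tamagawaProduct = 0 :=
    padicValNat.eq_zero_of_not_dvd fun h ↦ (Nat.not_even_iff_odd.mpr hTam) (even_iff_two_dvd.mpr h)
  obtain ⟨ℓ, p, hℓ, hp, hℓp, h3ℓ, hℓ8, hp8, hcong, hℓN, hpN, hsil, hid, Wd, _, _, hC, hSel, hDEF⟩ :=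
    exists_defectTwo_twin_of_strict W hΔ hsurj (s := 2) (by norm_num) h4' hstrict
  exact ⟨ℓ, p, hℓ, hp, hℓp, h3ℓ, hℓ8, hp8, hcong, hℓN, hpN, hsil, hid, Wd, inferInstance, inferInstance, hC, by simpa using hSel,
    by rw [hDEF, hW0]⟩

/-- **THE DEFECT-2 `2`-SELMER-TRIVIAL TWIN OF A REAL-STRICT `#Sel₂ = 2` CURVE (`s = 1`)** — the identity-locus door of crux U₂
`MinimalTwinBSDTwo` (LINE 23 «twin_swap» residual OFF″: `Δ > 0`, `#Sel₂(W) = 2`, strict at `ℝ` = off the egg; cf. gk2-p2 g26's prime-`d_K`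
identity door): at EVERY Tamagawa depth the defect-2 twin `Wd ≅ W^{(−ℓp)}` (ℓ silent, `p` an identity prime, both supplied here, globally
minimal) has `#Sel₂(Wd) = 1` and `ord₂ C(Wd) = ord₂ C(W) + 2` — UNCONDITIONALLY (Čebotarev supply included; no Tamagawa hypothesis).  BSD is
NOT proved by this; U₂ stays open.
[cite: MazurRubin2010, Prop. 5.2, Cor. 3.4 (i)] [cite: Kramer1981, §2 Prop. 3, Thm. 1] -/
theorem exists_defectTwo_selmerTrivialTwin_of_strict (W : WeierstrassCurve ℚ) [W.IsElliptic] [W.IsGloballyMinimal]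
    (hΔ : 0 < W.Δ) (hsurj : W.HasSurjectiveModNGaloisRep 2)
    (h2 : Nat.card (W.selmerGroup 2) = 2)
    (hstrict : ∀ c ∈ (W.kummerSelmerStructure ((2 : ℕ) : ℤ)).selmerGroup,
      galoisCohomology.localization (W.torsionGaloisModule ((2 : ℕ) : ℤ)) (Sum.inl Rat.infinitePlace) 1 c = 0) :
    ∃ ℓ p : ℕ, ℓ.Prime ∧ p.Prime ∧ ℓ ≠ p ∧ 3 < ℓ ∧ ℓ % 8 = 7 ∧ (p : ℤ) % 8 = 1 ∧
      (∀ r : ℕ, r.Prime → r ∣ W.conductorNorm ℤ → r ≠ 2 → (ℓ : ZMod r) = -1 ∧ (p : ZMod r) = 1) ∧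
      ¬ ℓ ∣ W.conductorNorm ℤ ∧ ¬ p ∣ W.conductorNorm ℤ ∧
      (∀ x : ZMod ℓ, 4 * x ^ 3 + ((integralModelInt W).b₂ : ZMod ℓ) * x ^ 2 +
        2 * ((integralModelInt W).b₄ : ZMod ℓ) * x + ((integralModelInt W).b₆ : ZMod ℓ) ≠ 0) ∧
      (∀ _h : Fact p.Prime, Nat.card {Q : (W.baseChange ℚ_[p]).toAffine.Point // 2 • Q = 0} = 4) ∧
      ∃ (Wd : WeierstrassCurve ℚ) (_ : Wd.IsElliptic) (_ : Wd.IsGloballyMinimal),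
        (∃ C : VariableChange ℚ, C • W.quadraticTwist ((-((ℓ : ℤ) * p) : ℤ) : ℚ) = Wd) ∧
        Nat.card (Wd.selmerGroup 2) = 1 ∧ padicValNat 2 Wd.tamagawaProduct = padicValNat 2 W.tamagawaProduct + 2 := by
  have h2' : Nat.card (W.selmerGroup 2) = 2 ^ 1 := by rw [h2]; norm_num
  obtain ⟨ℓ, p, hℓ, hp, hℓp, h3ℓ, hℓ8, hp8, hcong, hℓN, hpN, hsil, hid, Wd, _, _, hC, hSel, hDEF⟩ :=
    exists_defectTwo_twin_of_strict W hΔ hsurj (s := 1) le_rfl h2' hstrict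
  exact ⟨ℓ, p, hℓ, hp, hℓp, h3ℓ, hℓ8, hp8, hcong, hℓN, hpN, hsil, hid, Wd, inferInstance, inferInstance, hC, by simpa using hSel, hDEF⟩

/-! ## §3 LINE 24 «strict_def2» stub A⁼² `stub_minimalTwinSupplyAtTwoPosStrict` — its registered signature, PROVED -/

/-- **LINE 24 «strict_def2» STUB A⁼² `stub_minimalTwinSupplyAtTwoPosStrict` (crux `OffCutResidualAtTwoR`, stmt-BirchSwinnertonDyer-31767;
= the supply of LINE 27 «socle_selection»'s residual slice 3 `Δ > 0 ∧ #Sel₂ = 4 ∧ not real-narrow`) — ITS SIGNATURE VERBATIM, PROVED.**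
On the STRICT cell (habitat, `Δ > 0`, `#Sel₂(E) = 4`, every `2`-Selmer class trivial at `ℝ`) there is a Kolyvagin-(H2)-admissible
Heegner field `K` (odd `d_K ≠ −3`, the two Theorem-B₂ non-square clauses) and a GLOBALLY MINIMAL twin `Wd ≅ E^{(d_K)}` with
`#Sel₂(Wd) = 2` and `ord₂ C(Wd) = 2` — namely `K = ℚ(√(−ℓp))` of §2 (`ℓ` silent, `p` an identity prime: the card's type I with a
silent cofactor).  The habitat binders `¬ CM`, `r_an = 0`, `N ≠ 0` and the surjectivity beyond level `2` are idle.  UNCONDITIONAL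
(Čebotarev, Poitou–Tate, Tate's χ, Kramer's congruence are tree theorems).  BSD is NOT proved by this; the crux and LINE 24's
C⁼²/X⁼² stay open. [cite: MazurRubin2010, Prop. 5.2, Cor. 3.4 (i), Lemma 2.11] [cite: Kramer1981, §2 Prop. 3, Thm. 1]
[cite: GrossLMS1991, §1 (p. 235)] -/
theorem minimalTwinSupplyAtTwoPosStrict :
    ∀ (W : WeierstrassCurve ℚ) [W.IsElliptic] [W.IsGloballyMinimal] [NeZero (W.conductorNorm ℤ)],
      ¬ W.HasCM → W.analyticRank = 0 → (∀ n : ℕ, 0 < n → W.HasSurjectiveModNGaloisRep ((2 : ℤ) ^ n)) →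
      Odd W.tamagawaProduct → 0 < W.Δ →
      (Nat.card (W.selmerGroup 2) = 4 ∧ ∀ c ∈ (W.kummerSelmerStructure ((2 : ℕ) : ℤ)).selmerGroup,
        Literature.NumberTheory.GaloisRepresentations.galoisCohomology.localization (W.torsionGaloisModule ((2 : ℕ) : ℤ))
          (Sum.inl Rat.infinitePlace) 1 c = 0) →
      ∃ (K : Type) (_ : Field K) (_ : NumberField K),
        IsImaginaryQuadratic K ∧ Odd (NumberField.discr K) ∧ NumberField.discr K ≠ -3 ∧
        SatisfiesHeegnerHypothesis (W.conductorNorm ℤ) K ∧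
        ¬ IsSquare ((NumberField.discr K : ℚ) * -|W.Δ|) ∧ ¬ IsSquare ((NumberField.discr K : ℚ) * (-(2 * |W.Δ|))) ∧
        ∃ (Wd : WeierstrassCurve ℚ) (_ : Wd.IsElliptic) (_ : Wd.IsGloballyMinimal),
          (∃ C : WeierstrassCurve.VariableChange ℚ, C • W.quadraticTwist (NumberField.discr K : ℚ) = Wd) ∧
          Nat.card (Wd.selmerGroup 2) = 2 ∧ padicValNat 2 Wd.tamagawaProduct = 2 := by
  intro W _ _ _ _ _ hρ hTam hΔ hstrict
  have hsurj : W.HasSurjectiveModNGaloisRep 2 := by simpa using hρ 1 one_pos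
  obtain ⟨ℓ, p, hℓ, hp, hℓp, h3ℓ, hℓ8, hp8, hcong, hℓN, -, -, -, Wd, _, _, ⟨C, hC⟩, hSel, hDEF⟩ :=
    exists_defectTwo_minimalTwin_of_strict W hΔ hTam hsurj hstrict.1 hstrict.2
  obtain ⟨K, _, _, hIQ, hdisc, hodd, hne3, hHe, -, hsq1, hsq2⟩ := exists_heegnerField_neg_mul W hℓ hp hℓp h3ℓ hℓ8 hp8 hcong hℓN
  exact ⟨K, inferInstance, inferInstance, hIQ, hodd, hne3, hHe, hsq1, hsq2, Wd, inferInstance, inferInstance,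
    ⟨C, by rw [hdisc]; exact hC⟩, hSel, hDEF⟩

end Summit.BirchSwinnertonDyer.BirchSwinnertonDyer.Theorems.GenusExact.StrictDefTwo

end
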